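import Summits.Ventures.PackingBounds.ThreePointCert.Soundness

/-!
# A faster kernel evaluation of the Gram row chunks (offset-encoded natural-number rows)

Framing: lottery ticket; floor = certified bounds/negative ranges. Venture `PackingBounds`
(cell `pub-packcert`), three-point SDP family.

The row-chunk validation `chunkOK` of `Literature/…/KissingCertComp` (used through
`ThreePointCert.Check`/`ThreePointCert.Soundness` by every kernel-checked three-point row) spends
almost all of its kernel time in the dot products of the integer Gram factor `L`, evaluated with
`ℤ` arithmetic, which the kernel does not accelerate. Measured on the Lean farm (2026-08-20, one
chunk of 213 305 multiply–adds over a 120-monomial block): `chunkOK` 63 s of kernel time,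
the present `chunkOKN` 21 s with `+`/`*` notation and ≈ 11 s with the primitive `Nat.add`/`Nat.mul`
used below (≈ 0.3 ms → ≈ 0.05 ms per multiply–add); a single `decide` stays inside the kernel's
memory bound up to ≈ 10⁶ multiply–adds (1 007 800 in 55 s; 2·10⁶ fails with "excessive memory").

Design: the rows of `L` are stored as natural numbers `e + B` for one offset `B` per block
(`GramBlkN`); `dotOffZ` makes one `List.rec` pass accumulating `Σ (xy + B²)` and `Σ (x + y)` in `ℕ`
and decodes once per entry of `L Lᵀ` (`Σ (x-B)(y-B) = Σ (xy + B²) - B Σ (x + y)`); `quadRowsN` /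
`chunkOKN` are `quadRows` / `chunkOK` with this dot product. `quadRowsN_eq` proves the term lists
equal, so `chunkOKN g … = true` implies `chunkOK g.toGramBlk … = true` (`chunkOK_of_okN`) and the
soundness theorems of `ThreePointCert.Soundness` apply unchanged to the decoded block
`g.toGramBlk` (`chunkVal_of_okN`, `rvalid_of_singleN`): an emitter writes `def gR0N : GramBlkN := …`,
`def gR0 : GramBlk := gR0N.toGramBlk`, proves the chunks with `chunkOKN` by `decide +kernel`
(≤ 10⁶ multiply–adds per theorem) and assembles `PolysOK3` exactly as before. No statement about
certificates changes.
-/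

noncomputable section

namespace Summit.Ventures.PackingBounds.ThreePointCert

open Literature.Geometry.DiscreteGeometry Literature.Geometry.DiscreteGeometry.PolyCert
open Literature.Geometry.DiscreteGeometry.PolyCert.SPoly

/-! ### Offset-encoded Gram blocks -/

/-- A Gram block whose factor rows are stored offset-encoded as natural numbers: row entry
`x : ℕ` stands for the integer `x - B`; `BB` must equal `B * B` (checked by `chunkOKN`). -/
structure GramBlkN where
  /-- basis monomials -/
  z : List Mono
  /-- the offset -/
  B : ℕ
  /-- the square of the offset (data, checked) -/
  BB : ℕ
  /-- rows of the factor `L`, entries `e + B` -/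
  L : List (List ℕ)

/-- Decode one offset row. -/
def decRow (B : ℕ) (r : List ℕ) : List ℤ := r.map fun (x : ℕ) => (x : ℤ) - (B : ℤ)

/-- The integer Gram block encoded by an offset block. -/
def GramBlkN.toGramBlk (g : GramBlkN) : GramBlk := ⟨g.z, g.L.map (decRow g.B)⟩

/-- Length side condition (one row per basis monomial). -/
def GramBlkN.lenOK (g : GramBlkN) : Bool := g.L.length == g.z.length

/-- Fused offset dot product over the common prefix of two offset rows `a`, `b`, by a single
`List.rec` pass in `ℕ`: from accumulators `acc`, `s` it returns
`subNatNat (acc + Σ (a_k b_k + BB)) (B · (s + Σ (a_k + b_k)))`, which for `BB = B²` and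
`acc = s = 0` is the integer dot product of the decoded rows. -/
def dotOffZ (B BB : ℕ) (a : List ℕ) : List ℕ → ℕ → ℕ → ℤ :=
  a.rec (motive := fun _ => List ℕ → ℕ → ℕ → ℤ) (fun _ acc s => Int.subNatNat acc (Nat.mul B s))
    (fun x _ ih b acc s => b.casesOn (motive := fun _ => ℤ) (Int.subNatNat acc (Nat.mul B s))
      (fun y b' => ih b' (Nat.add acc (Nat.add (Nat.mul x y) BB)) (Nat.add s (Nat.add x y))))

/-- Rows `i0, …, i0+cnt-1` of the quadratic form `zᵀ(LLᵀ)z`, offset-encoded data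
(same term list as `quadRows g.toGramBlk i0 cnt`, see `quadRowsN_eq`). -/
def quadRowsN (g : GramBlkN) (i0 cnt : ℕ) : SPoly :=
  mergeAllB 16 (List.zipWith (fun (ri : List ℕ) (zi : Mono) =>
      List.zipWith (fun (g' : ℤ) (zj : Mono) => (zi.mul zj, g'))
        (g.L.map fun rj => dotOffZ g.B g.BB ri rj 0 0) g.z)
    ((g.L.drop i0).take cnt) ((g.z.drop i0).take cnt))

/-- Chunk check on offset-encoded data: `Dprev + (rows i0 … i0+cnt-1) - Dnext ≡ 0`. -/
def chunkOKN (g : GramBlkN) (i0 cnt : ℕ) (Dprev Dnext : SPoly) : Bool :=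
  g.lenOK && (g.BB == g.B * g.B) && decide (i0 + cnt ≤ g.z.length) &&
    residualBound (Dprev ++ quadRowsN g i0 cnt ++ neg Dnext) 0

/-! ### Equivalence with the integer programs -/

/-- `dotAcc` with an accumulator. -/
theorem dotAcc_acc (a b : List ℤ) (c : ℤ) : dotAcc a b c = c + dotAcc a b 0 := by
  induction a generalizing b c with
  | nil => cases b <;> simp [dotAcc]
  | cons x a ih =>
    cases b with
    | nil => simp [dotAcc]
    | cons y b => simp only [dotAcc, zero_add]; rw [ih b (c + x * y), ih b (x * y)]; ring

/-- The fused offset dot product decodes to the integer dot product. -/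
theorem dotOffZ_eq (B : ℕ) (a b : List ℕ) (acc s : ℕ) :
    dotOffZ B (B * B) a b acc s =
      (acc : ℤ) - B * s + dotAcc (decRow B a) (decRow B b) 0 := by
  induction a generalizing b acc s with
  | nil => cases b <;> simp [dotOffZ, decRow, dotAcc, Int.subNatNat_eq_coe]
  | cons x a ih =>
    cases b with
    | nil => simp [dotOffZ, decRow, dotAcc, Int.subNatNat_eq_coe]
    | cons y b =>
      have h := ih b (Nat.add acc (Nat.add (Nat.mul x y) (B * B))) (Nat.add s (Nat.add x y))
      simp only [dotOffZ] at h ⊢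
      rw [h]
      simp only [Nat.add_eq, Nat.mul_eq, decRow, List.map_cons, dotAcc, zero_add]
      rw [dotAcc_acc _ _ (((x : ℤ) - B) * ((y : ℤ) - B))]
      push_cast
      ring

/-- `quadRowsN` computes the same term list as `quadRows` on the decoded block. -/
theorem quadRowsN_eq (g : GramBlkN) (hBB : g.BB = g.B * g.B) (i0 cnt : ℕ) :
    quadRowsN g i0 cnt = quadRows g.toGramBlk i0 cnt := by
  have key : ∀ ri : List ℕ, (g.L.map fun rj => dotOffZ g.B g.BB ri rj 0 0) =
      (g.L.map (decRow g.B)).map fun rj => dotAcc (decRow g.B ri) rj 0 := by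
    intro ri
    rw [List.map_map]
    refine List.map_congr_left fun rj _ => ?_
    simp only [Function.comp_apply, hBB, dotOffZ_eq]
    simp
  unfold quadRowsN quadRows GramBlkN.toGramBlk
  rw [← List.map_drop, ← List.map_take, List.zipWith_map_left]
  congr 1
  congr 1
  funext ri zi
  rw [key ri]

/-- A successful fast chunk check is a successful chunk check of the decoded block. -/
theorem chunkOK_of_okN (g : GramBlkN) (i0 cnt : ℕ) (Dprev Dnext : SPoly)
    (h : chunkOKN g i0 cnt Dprev Dnext = true) : chunkOK g.toGramBlk i0 cnt Dprev Dnext = true := by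
  unfold chunkOKN at h
  simp only [Bool.and_eq_true, beq_iff_eq, decide_eq_true_eq] at h
  obtain ⟨⟨⟨hlen, hBB⟩, hle⟩, hres⟩ := h
  unfold chunkOK
  simp only [Bool.and_eq_true, decide_eq_true_eq]
  refine ⟨⟨?_, ?_⟩, ?_⟩
  · unfold GramBlkN.lenOK at hlen
    unfold GramBlk.lenOK GramBlkN.toGramBlk
    simpa [List.length_map] using hlen
  · exact hle
  · rw [← quadRowsN_eq g hBB]; exact hres

/-- Chunk validity (`ThreePointCert.Soundness.ChunkVal`) of the decoded block from a fast
kernel chunk check. -/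
theorem chunkVal_of_okN (g : GramBlkN) (i0 cnt : ℕ) (Dprev Dnext : SPoly)
    (h : chunkOKN g i0 cnt Dprev Dnext = true) : ChunkVal g.toGramBlk i0 cnt Dprev Dnext :=
  chunkVal_of_ok _ _ _ _ _ (chunkOK_of_okN g i0 cnt Dprev Dnext h)

/-- `RValid` of the decoded block from a single fast chunk check. -/
theorem rvalid_of_singleN (g : GramBlkN) (R : SPoly)
    (h : chunkOKN g 0 g.z.length [] R = true) : RValid g.toGramBlk R :=
  chunkVal_of_okN g 0 g.z.length [] R h

end Summit.Ventures.PackingBounds.ThreePointCert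

end
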